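import Literature.NumberTheory.ModularForms.SiegelThetaNullTransformation
import HarnessLib

/-!
# The multiplier of `ϑ²` on the theta group is a character, with its values on generators (Lange Ex. 3.3.4 (7))

For `M = (α β; γ δ)` in the theta group `Γ_{1,2} ⊂ Sp_{2g}(ℤ)` let `C(Z, M)` be the constant of the
theta transformation formula `ϑ(ᵗ(γZ + δ)⁻¹v, M(Z)) = C(Z, M) · e(πi ᵗv(γZ + δ)⁻¹γv) · ϑ(v, Z)`
(`SiegelThetaModularGroup.exists_riemannTheta_transform_of_mem_thetaModularGroup`) and `u(M) ∈ ℂ₁`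
the unit with `C(Z, M)² = u(M) det(γZ + δ)` for all `Z ∈ 𝔥_g`
(`SiegelThetaNullTransformation.exists_unit_sq_riemannTheta_transform_const_of_mem_thetaModularGroup`).
Lange, Exercise 3.3.4 (7)(a): "`κ²: Sp_{2g}(ℤ) → ℂ₁^*` is a homomorphism of groups" (for `M ∈ Γ_{1,2}`
the tree's `C(Z, M)` is the printed `C(Z, M, 0)⁻¹` up to a sign depending only on `M`, so
`u = κ⁻²` there). This file proves the `Γ_{1,2}` case in the tree's normalisation, by the two cocycle
identities behind it:

* `transpose_denom_mul_sub_moeb_mul` — `ᵗ(γZ + δ)(α - M(Z)γ) = 1`, i.e. `α - M(Z)γ = ᵗ(γZ + δ)⁻¹`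
  (Lemma 3.1.3 / Cor. 3.1.5);
* `denom_inv_mul_toBlocks₂₁_mul` — for `P = P₁P₂`:
  `(γZ + δ)⁻¹γ = D₂⁻¹ · ((γ₁Z₂ + δ₁)⁻¹γ₁) · ᵗD₂⁻¹ + (γ₂Z + δ₂)⁻¹γ₂` with `Z₂ = M₂(Z)`,
  `D₂ = γ₂Z + δ₂` (the quadratic forms `ᵗv(γZ + δ)⁻¹γv` of Thm. 3.3.9 compose additively along
  `v ↦ ᵗD₂⁻¹v`), next to the tree's `denom_mul_eq` (`γZ + δ = (γ₁Z₂ + δ₁)(γ₂Z + δ₂)`) and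
  `moeb_mul` (`(M₁M₂)(Z) = M₁(M₂(Z))`);
* `riemannTheta_transform_const_mul` — hence `C(M₂(Z), M₁) · C(Z, M₂)` is a transformation constant
  for `M₁M₂` at `Z` (`M₁, M₂ ∈ Γ_{1,2}`);
* **`exists_thetaMultiplier_hom`** — there is a monoid homomorphism `u : Γ_{1,2} →* ℂ` with
  `|u(M)| = 1` and `C² = u(M) det(γZ + δ)` for every `M ∈ Γ_{1,2}`, `Z ∈ 𝔥_g` and every
  transformation constant `C` of `M` at `Z`; in particular (`ϑ²` is a modular form of weight one for
  `Γ_{1,2}` with CHARACTER `u`) `ϑ(0, M(Z))² = u(M) det(γZ + δ) ϑ(0, Z)²`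
  (`exists_thetaMultiplier_hom_riemannTheta_zero_moeb_sq`);
* §3, Exercise 3.3.4 (7)(c) on the generators inside `Γ_{1,2}`: `sq_transform_const_translation`
  (`u(1 β; 0 1) = 1`, `β` symmetric with even diagonal: `C = 1`), `sq_transform_const_diag`
  (`u(α 0; 0 ᵗα⁻¹) = det α`: `C = 1`), `thetaMultiplier_translation_diag` — from the tree's explicit
  transformation laws `riemannThetaChar_transform_translation/diag` (`RiemannThetaTransformation` §9);
* §4 **`sq_transform_const_J`**, `thetaMultiplier_J` — `u(J) = (-i)^g` for `J = (0 -1; 1 0)` (the first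
  value of Exercise 3.3.4 (7)(c), `κ²(0 1; -1 0) = (-i)^g`, read for `J = (0 1; -1 0)⁻¹` with
  `u = κ⁻²`), WITHOUT Poisson summation: at the fixed point `Z₀ = i1_g` of `J` the transformation law
  at `v = 0` is `ϑ(0, i1_g) = C₀ ϑ(0, i1_g)`, so `C₀ = 1`, `u(J) = C₀²/det(i1_g) = (-i)^g`, and `u(J)`
  does not depend on `Z`; for `g = 1` this squares the tree's `riemannThetaChar_transform_J_fin_one`
  (`C(τ)² = -iτ`); `exists_riemannTheta_inv_transform_sq` — the theta inversion formula squared: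
  `ϑ(Z⁻¹v, -Z⁻¹) = C e(πi ᵗvZ⁻¹v) ϑ(v, Z)` with `C² = (-i)^g det Z`.

Theorems only; no definitions (the homomorphism is produced inside an existential), no named facts.

## References

* [Lange2023AbelianVarietiesComplex] H. Lange, *Abelian Varieties over the Complex Numbers* (2023),
  §3.1.2 Lemma 3.1.3, Cor. 3.1.5 (p0159–p0160); §3.1.3 Prop. 3.1.6 (p0160); §3.3.3 Thm. 3.3.9
  (p0175–p0177); §3.3.4 Exercise (7)(a),(c) (p0179); §3.5.1 Lemma 3.5.1 (p0186).
* [MumfordTata1] D. Mumford, *Tata Lectures on Theta I* (1983), Ch. II §5.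
-/

noncomputable section

open Matrix Complex Real

namespace Literature.NumberTheory.ModularForms

open Literature.NumberTheory.Automorphic (siegelUpperHalfSpace)
open Literature.NumberTheory.ModularForms.SiegelUpperHalfSpace
open Literature.Analysis.SpecialFunctions

variable {g : ℕ}

/-! ### §1 The two cocycle identities -/

section Cocycle

variable {P P₁ P₂ : Matrix (Fin g ⊕ Fin g) (Fin g ⊕ Fin g) ℂ} {Z : Matrix (Fin g) (Fin g) ℂ}

/-- **`ᵗ(γZ + δ)(α - M(Z)γ) = 1`** for `P = (α β; γ δ) ∈ Sp_{2g}(ℂ)`, `Z` symmetric, `γZ + δ` invertible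
(from `ᵗ(γZ + δ) = Zᵗγ + ᵗδ`, `ᵗ(γZ + δ)M(Z) = Zᵗα + ᵗβ` (Cor. 3.1.5) and the symplectic relations
`ᵗγα = ᵗαγ`, `ᵗδα - ᵗβγ = 1` (Lemma 3.1.3)).
[cite: Lange2023AbelianVarietiesComplex, §3.1.2 Lemma 3.1.3, Cor. 3.1.5 (p0159–p0160)] -/
theorem transpose_denom_mul_sub_moeb_mul (hP : P ∈ Matrix.symplecticGroup (Fin g) ℂ)
    (hZs : Z.IsSymm) (h : IsUnit (denom P Z).det) :
    (denom P Z)ᵀ * (P.toBlocks₁₁ - moeb P Z * P.toBlocks₂₁) = 1 := by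
  obtain ⟨h1, -, h3⟩ := blocks_rel hP
  have h3' : P.toBlocks₂₂ᵀ * P.toBlocks₁₁ - P.toBlocks₁₂ᵀ * P.toBlocks₂₁ = 1 := by
    have := congrArg transpose h3
    rwa [transpose_sub, transpose_mul, transpose_mul, transpose_transpose, transpose_transpose,
      transpose_one] at this
  rw [Matrix.mul_sub, ← Matrix.mul_assoc, transpose_denom_mul_moeb hP hZs h, transpose_denom_eq P hZs,
    Matrix.add_mul, Matrix.add_mul, Matrix.mul_assoc, Matrix.mul_assoc, ← h1, ← h3']
  noncomm_ring

/-- **`α - M(Z)γ = ᵗ(γZ + δ)⁻¹`.** [cite: Lange2023AbelianVarietiesComplex, §3.1.2 Cor. 3.1.5 (p0160)] -/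
theorem toBlocks₁₁_sub_moeb_mul_toBlocks₂₁ (hP : P ∈ Matrix.symplecticGroup (Fin g) ℂ)
    (hZs : Z.IsSymm) (h : IsUnit (denom P Z).det) :
    P.toBlocks₁₁ - moeb P Z * P.toBlocks₂₁ = (denom P Z)ᵀ⁻¹ :=
  (Matrix.inv_eq_right_inv (transpose_denom_mul_sub_moeb_mul hP hZs h)).symm

/-- The `(2,1)`-block of a product: `(P₁P₂)₂₁ = γ₁α₂ + δ₁γ₂`. [folklore] -/
private theorem toBlocks₂₁_mul (P₁ P₂ : Matrix (Fin g ⊕ Fin g) (Fin g ⊕ Fin g) ℂ) :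
    (P₁ * P₂).toBlocks₂₁ = P₁.toBlocks₂₁ * P₂.toBlocks₁₁ + P₁.toBlocks₂₂ * P₂.toBlocks₂₁ := by
  ext i j
  simp [toBlocks₁₁, toBlocks₂₁, toBlocks₂₂, Matrix.mul_apply, Fintype.sum_sum_type]

/-- **The cocycle of the quadratic forms of Thm. 3.3.9**: for `P = P₁P₂`, `Z₂ = M₂(Z)`,
`D₂ = γ₂Z + δ₂`:
`(γZ + δ)⁻¹γ = D₂⁻¹ ((γ₁Z₂ + δ₁)⁻¹γ₁) ᵗD₂⁻¹ + (γ₂Z + δ₂)⁻¹γ₂`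
(from `γZ + δ = (γ₁Z₂ + δ₁)D₂`, `γ = γ₁α₂ + δ₁γ₂` and `α₂ = ᵗD₂⁻¹ + Z₂γ₂`).
[cite: Lange2023AbelianVarietiesComplex, §3.1.3 Prop. 3.1.6 (p0160); §3.3.3 Thm. 3.3.9 (p0175)] -/
theorem denom_inv_mul_toBlocks₂₁_mul (hP₂ : P₂ ∈ Matrix.symplecticGroup (Fin g) ℂ)
    (hZs : Z.IsSymm) (h₂ : IsUnit (denom P₂ Z).det) (h₁ : IsUnit (denom P₁ (moeb P₂ Z)).det) :
    (denom (P₁ * P₂) Z)⁻¹ * (P₁ * P₂).toBlocks₂₁ =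
      (denom P₂ Z)⁻¹ * ((denom P₁ (moeb P₂ Z))⁻¹ * P₁.toBlocks₂₁) * (denom P₂ Z)ᵀ⁻¹ +
        (denom P₂ Z)⁻¹ * P₂.toBlocks₂₁ := by
  have hα : P₂.toBlocks₁₁ = (denom P₂ Z)ᵀ⁻¹ + moeb P₂ Z * P₂.toBlocks₂₁ := by
    rw [← toBlocks₁₁_sub_moeb_mul_toBlocks₂₁ hP₂ hZs h₂, sub_add_cancel]
  have hγ : (P₁ * P₂).toBlocks₂₁ =
      P₁.toBlocks₂₁ * (denom P₂ Z)ᵀ⁻¹ + denom P₁ (moeb P₂ Z) * P₂.toBlocks₂₁ := by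
    rw [toBlocks₂₁_mul, hα, denom_def P₁ (moeb P₂ Z), Matrix.mul_add, Matrix.add_mul, Matrix.mul_assoc]
    abel
  rw [denom_mul_eq h₂, hγ, Matrix.mul_inv_rev, Matrix.mul_add]
  simp only [Matrix.mul_assoc, Matrix.nonsing_inv_mul_cancel_left _ _ h₁]

/-- The quadratic form of the cocycle: `ᵗv((γZ + δ)⁻¹γ)v = ᵗw((γ₁Z₂ + δ₁)⁻¹γ₁)w + ᵗv((γ₂Z + δ₂)⁻¹γ₂)v`
with `w = ᵗD₂⁻¹v`. [cite: Lange2023AbelianVarietiesComplex, §3.3.3 Thm. 3.3.9 (p0175)] -/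
theorem dotProduct_denom_inv_mul_toBlocks₂₁_mul_mulVec (hP₂ : P₂ ∈ Matrix.symplecticGroup (Fin g) ℂ)
    (hZs : Z.IsSymm) (h₂ : IsUnit (denom P₂ Z).det) (h₁ : IsUnit (denom P₁ (moeb P₂ Z)).det)
    (v : Fin g → ℂ) :
    v ⬝ᵥ ((denom (P₁ * P₂) Z)⁻¹ * (P₁ * P₂).toBlocks₂₁) *ᵥ v =
      ((denom P₂ Z)ᵀ⁻¹ *ᵥ v) ⬝ᵥ ((denom P₁ (moeb P₂ Z))⁻¹ * P₁.toBlocks₂₁) *ᵥ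
          ((denom P₂ Z)ᵀ⁻¹ *ᵥ v) +
        v ⬝ᵥ ((denom P₂ Z)⁻¹ * P₂.toBlocks₂₁) *ᵥ v := by
  rw [denom_inv_mul_toBlocks₂₁_mul hP₂ hZs h₂ h₁, add_mulVec, dotProduct_add, ← mulVec_mulVec,
    ← mulVec_mulVec, dotProduct_mulVec v (denom P₂ Z)⁻¹, ← mulVec_transpose, transpose_nonsing_inv]

end Cocycle

/-! ### §2 Transformation constants multiply along `M₁M₂` -/

section Multiplier

/-- **`C(M₂(Z), M₁) · C(Z, M₂)` is a transformation constant for `M₁M₂` at `Z`** (`M₁, M₂ ∈ Γ_{1,2}`,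
`Z ∈ 𝔥_g`): composing the two transformation laws along `ᵗ(γZ + δ)⁻¹ = ᵗD₁⁻¹ ᵗD₂⁻¹`,
`(M₁M₂)(Z) = M₁(M₂(Z))` and the additivity of the quadratic forms
(`dotProduct_denom_inv_mul_toBlocks₂₁_mul_mulVec`).
[cite: Lange2023AbelianVarietiesComplex, §3.3.3 Thm. 3.3.9 (p0175); §3.3.4 Exercise (7)(a) (p0179)] [cite: MumfordTata1, Ch. II §5] -/
theorem riemannTheta_transform_const_mul {M₁ M₂ : Matrix.symplecticGroup (Fin g) ℤ}
    {Z : Matrix (Fin g) (Fin g) ℂ} (hZ : Z ∈ siegelUpperHalfSpace g) {C₁ C₂ : ℂ}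
    (hC₁ : ∀ w : Fin g → ℂ,
      riemannTheta (moeb ((M₁ : Matrix (Fin g ⊕ Fin g) (Fin g ⊕ Fin g) ℤ).map ((↑) : ℤ → ℂ))
          (moeb ((M₂ : Matrix (Fin g ⊕ Fin g) (Fin g ⊕ Fin g) ℤ).map ((↑) : ℤ → ℂ)) Z))
          ((denom ((M₁ : Matrix (Fin g ⊕ Fin g) (Fin g ⊕ Fin g) ℤ).map ((↑) : ℤ → ℂ))
            (moeb ((M₂ : Matrix (Fin g ⊕ Fin g) (Fin g ⊕ Fin g) ℤ).map ((↑) : ℤ → ℂ)) Z))ᵀ⁻¹ *ᵥ w) =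
        C₁ * cexp (π * I * (w ⬝ᵥ ((denom ((M₁ : Matrix (Fin g ⊕ Fin g) (Fin g ⊕ Fin g) ℤ).map
              ((↑) : ℤ → ℂ)) (moeb ((M₂ : Matrix (Fin g ⊕ Fin g) (Fin g ⊕ Fin g) ℤ).map
              ((↑) : ℤ → ℂ)) Z))⁻¹ *
            ((M₁ : Matrix (Fin g ⊕ Fin g) (Fin g ⊕ Fin g) ℤ).map ((↑) : ℤ → ℂ)).toBlocks₂₁) *ᵥ w)) *
          riemannTheta (moeb ((M₂ : Matrix (Fin g ⊕ Fin g) (Fin g ⊕ Fin g) ℤ).map ((↑) : ℤ → ℂ)) Z) w)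
    (hC₂ : ∀ v : Fin g → ℂ,
      riemannTheta (moeb ((M₂ : Matrix (Fin g ⊕ Fin g) (Fin g ⊕ Fin g) ℤ).map ((↑) : ℤ → ℂ)) Z)
          ((denom ((M₂ : Matrix (Fin g ⊕ Fin g) (Fin g ⊕ Fin g) ℤ).map ((↑) : ℤ → ℂ)) Z)ᵀ⁻¹ *ᵥ v) =
        C₂ * cexp (π * I * (v ⬝ᵥ ((denom ((M₂ : Matrix (Fin g ⊕ Fin g) (Fin g ⊕ Fin g) ℤ).map
              ((↑) : ℤ → ℂ)) Z)⁻¹ *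
            ((M₂ : Matrix (Fin g ⊕ Fin g) (Fin g ⊕ Fin g) ℤ).map ((↑) : ℤ → ℂ)).toBlocks₂₁) *ᵥ v)) *
          riemannTheta Z v) (v : Fin g → ℂ) :
    riemannTheta (moeb (((M₁ * M₂ : Matrix.symplecticGroup (Fin g) ℤ) :
          Matrix (Fin g ⊕ Fin g) (Fin g ⊕ Fin g) ℤ).map ((↑) : ℤ → ℂ)) Z)
        ((denom (((M₁ * M₂ : Matrix.symplecticGroup (Fin g) ℤ) :
          Matrix (Fin g ⊕ Fin g) (Fin g ⊕ Fin g) ℤ).map ((↑) : ℤ → ℂ)) Z)ᵀ⁻¹ *ᵥ v) =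
      C₁ * C₂ * cexp (π * I * (v ⬝ᵥ ((denom (((M₁ * M₂ : Matrix.symplecticGroup (Fin g) ℤ) :
            Matrix (Fin g ⊕ Fin g) (Fin g ⊕ Fin g) ℤ).map ((↑) : ℤ → ℂ)) Z)⁻¹ *
          (((M₁ * M₂ : Matrix.symplecticGroup (Fin g) ℤ) :
            Matrix (Fin g ⊕ Fin g) (Fin g ⊕ Fin g) ℤ).map ((↑) : ℤ → ℂ)).toBlocks₂₁) *ᵥ v)) *
        riemannTheta Z v := by
  set P₁ : Matrix (Fin g ⊕ Fin g) (Fin g ⊕ Fin g) ℂ :=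
    (M₁ : Matrix (Fin g ⊕ Fin g) (Fin g ⊕ Fin g) ℤ).map ((↑) : ℤ → ℂ) with hP₁
  set P₂ : Matrix (Fin g ⊕ Fin g) (Fin g ⊕ Fin g) ℂ :=
    (M₂ : Matrix (Fin g ⊕ Fin g) (Fin g ⊕ Fin g) ℤ).map ((↑) : ℤ → ℂ) with hP₂
  have hP : (((M₁ * M₂ : Matrix.symplecticGroup (Fin g) ℤ) :
      Matrix (Fin g ⊕ Fin g) (Fin g ⊕ Fin g) ℤ).map ((↑) : ℤ → ℂ)) = P₁ * P₂ := by
    rw [Submonoid.coe_mul, hP₁, hP₂]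
    exact Matrix.map_mul (f := Int.castRingHom ℂ)
  have hP₂mem : P₂ ∈ Matrix.symplecticGroup (Fin g) ℂ := map_intCast_mem M₂.2
  have h₂ : IsUnit (denom P₂ Z).det := isUnit_det_denom_intCast M₂.2 hZ
  have hZ₂ : moeb P₂ Z ∈ siegelUpperHalfSpace g := moeb_intCast_mem M₂.2 hZ
  have h₁ : IsUnit (denom P₁ (moeb P₂ Z)).det := isUnit_det_denom_intCast M₁.2 hZ₂
  have h₂T : IsUnit (denom P₂ Z)ᵀ.det := by rwa [det_transpose]
  have h₁T : IsUnit (denom P₁ (moeb P₂ Z))ᵀ.det := by rwa [det_transpose]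
  rw [hP, dotProduct_denom_inv_mul_toBlocks₂₁_mul_mulVec hP₂mem hZ.1 h₂ h₁ v, moeb_mul h₂,
    denom_mul_eq h₂, transpose_mul, Matrix.mul_inv_rev, ← mulVec_mulVec, hC₁, hC₂, mul_add,
    Complex.exp_add]
  ring

/-- `u(M)` is determined by the property `C(Z, M)² = u(M) det(γZ + δ)` (evaluate at `Z = i1_g`).
[cite: Lange2023AbelianVarietiesComplex, §3.3.3 Thm. 3.3.9 (p0175)] -/
theorem thetaMultiplier_unique {M : Matrix.symplecticGroup (Fin g) ℤ} (hM : M ∈ thetaModularGroup g)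
    {u u' : ℂ}
    (hu : (∀ (Z : Matrix (Fin g) (Fin g) ℂ), Z ∈ siegelUpperHalfSpace g → ∀ C : ℂ,
        (∀ v : Fin g → ℂ,
          riemannTheta (moeb ((M : Matrix (Fin g ⊕ Fin g) (Fin g ⊕ Fin g) ℤ).map ((↑) : ℤ → ℂ)) Z)
              ((denom ((M : Matrix (Fin g ⊕ Fin g) (Fin g ⊕ Fin g) ℤ).map ((↑) : ℤ → ℂ)) Z)ᵀ⁻¹ *ᵥ v) =
            C * cexp (π * I * (v ⬝ᵥ ((denom ((M : Matrix (Fin g ⊕ Fin g) (Fin g ⊕ Fin g) ℤ).map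
                  ((↑) : ℤ → ℂ)) Z)⁻¹ *
                ((M : Matrix (Fin g ⊕ Fin g) (Fin g ⊕ Fin g) ℤ).map ((↑) : ℤ → ℂ)).toBlocks₂₁) *ᵥ v)) *
              riemannTheta Z v) →
        C ^ 2 = u * (denom ((M : Matrix (Fin g ⊕ Fin g) (Fin g ⊕ Fin g) ℤ).map ((↑) : ℤ → ℂ)) Z).det))
    (hu' : (∀ (Z : Matrix (Fin g) (Fin g) ℂ), Z ∈ siegelUpperHalfSpace g → ∀ C : ℂ,
        (∀ v : Fin g → ℂ,
          riemannTheta (moeb ((M : Matrix (Fin g ⊕ Fin g) (Fin g ⊕ Fin g) ℤ).map ((↑) : ℤ → ℂ)) Z)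
              ((denom ((M : Matrix (Fin g ⊕ Fin g) (Fin g ⊕ Fin g) ℤ).map ((↑) : ℤ → ℂ)) Z)ᵀ⁻¹ *ᵥ v) =
            C * cexp (π * I * (v ⬝ᵥ ((denom ((M : Matrix (Fin g ⊕ Fin g) (Fin g ⊕ Fin g) ℤ).map
                  ((↑) : ℤ → ℂ)) Z)⁻¹ *
                ((M : Matrix (Fin g ⊕ Fin g) (Fin g ⊕ Fin g) ℤ).map ((↑) : ℤ → ℂ)).toBlocks₂₁) *ᵥ v)) *
              riemannTheta Z v) →
        C ^ 2 = u' * (denom ((M : Matrix (Fin g ⊕ Fin g) (Fin g ⊕ Fin g) ℤ).map ((↑) : ℤ → ℂ)) Z).det)) :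
    u = u' := by
  have hI : (Complex.I • (1 : Matrix (Fin g) (Fin g) ℂ)) ∈ siegelUpperHalfSpace g :=
    ⟨isSymm_I_smul_one, posDef_im_I_smul_one⟩
  obtain ⟨C, -, hC⟩ := exists_riemannTheta_transform_of_mem_thetaModularGroup hM hI
  have hdet : (denom ((M : Matrix (Fin g ⊕ Fin g) (Fin g ⊕ Fin g) ℤ).map ((↑) : ℤ → ℂ)) (Complex.I • (1 : Matrix (Fin g) (Fin g) ℂ))).det ≠ 0 :=
    (isUnit_det_denom_intCast M.2 hI).ne_zero
  exact mul_right_cancel₀ hdet ((hu _ hI C hC).symm.trans (hu' _ hI C hC))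

/-- For `M = 1_{2g}` every transformation constant is `C = 1`, so `u(1) = 1`.
[cite: Lange2023AbelianVarietiesComplex, §3.3.3 Thm. 3.3.9 (p0175)] -/
theorem sq_transform_const_one :
    (∀ (Z : Matrix (Fin g) (Fin g) ℂ), Z ∈ siegelUpperHalfSpace g → ∀ C : ℂ,
        (∀ v : Fin g → ℂ,
          riemannTheta (moeb (((1 : Matrix.symplecticGroup (Fin g) ℤ) : Matrix (Fin g ⊕ Fin g) (Fin g ⊕ Fin g) ℤ).map ((↑) : ℤ → ℂ)) Z)
              ((denom (((1 : Matrix.symplecticGroup (Fin g) ℤ) : Matrix (Fin g ⊕ Fin g) (Fin g ⊕ Fin g) ℤ).map ((↑) : ℤ → ℂ)) Z)ᵀ⁻¹ *ᵥ v) =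
            C * cexp (π * I * (v ⬝ᵥ ((denom (((1 : Matrix.symplecticGroup (Fin g) ℤ) : Matrix (Fin g ⊕ Fin g) (Fin g ⊕ Fin g) ℤ).map
                  ((↑) : ℤ → ℂ)) Z)⁻¹ *
                (((1 : Matrix.symplecticGroup (Fin g) ℤ) : Matrix (Fin g ⊕ Fin g) (Fin g ⊕ Fin g) ℤ).map ((↑) : ℤ → ℂ)).toBlocks₂₁) *ᵥ v)) *
              riemannTheta Z v) →
        C ^ 2 = 1 * (denom (((1 : Matrix.symplecticGroup (Fin g) ℤ) : Matrix (Fin g ⊕ Fin g) (Fin g ⊕ Fin g) ℤ).map ((↑) : ℤ → ℂ)) Z).det) := by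
  intro Z hZ C hC
  have hP1 : ((1 : Matrix.symplecticGroup (Fin g) ℤ) : Matrix (Fin g ⊕ Fin g) (Fin g ⊕ Fin g) ℤ).map
      ((↑) : ℤ → ℂ) = 1 := by
    rw [OneMemClass.coe_one]
    exact Matrix.map_one _ Int.cast_zero Int.cast_one
  have hden : denom (1 : Matrix (Fin g ⊕ Fin g) (Fin g ⊕ Fin g) ℂ) Z = 1 := by
    rw [← fromBlocks_one, denom_fromBlocks, Matrix.zero_mul, zero_add]
  have hmo : moeb (1 : Matrix (Fin g ⊕ Fin g) (Fin g ⊕ Fin g) ℂ) Z = Z := by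
    rw [moeb_def, hden, inv_one, Matrix.mul_one, ← fromBlocks_one, num_fromBlocks, Matrix.one_mul,
      add_zero]
  have h21 : (1 : Matrix (Fin g ⊕ Fin g) (Fin g ⊕ Fin g) ℂ).toBlocks₂₁ = 0 := by
    rw [← fromBlocks_one, toBlocks_fromBlocks₂₁]
  rw [hP1, hden, det_one, mul_one]
  obtain ⟨v, hv⟩ := exists_riemannTheta_ne_zero_of_posDef Z hZ.2
  have h := hC v
  rw [hP1, hden, hmo, h21, transpose_one, inv_one, one_mulVec, Matrix.mul_zero, zero_mulVec,
    dotProduct_zero, mul_zero, Complex.exp_zero, mul_one] at h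
  have hC1 : C = 1 := by
    have : C * riemannTheta Z v = 1 * riemannTheta Z v := by rw [one_mul]; exact h.symm
    exact mul_right_cancel₀ hv this
  rw [hC1, one_pow]

/-- **`u(M₁M₂) = u(M₁)u(M₂)`**: if `u₁, u₂` are the multipliers of `M₁, M₂ ∈ Γ_{1,2}` then `u₁u₂`
is the multiplier of `M₁M₂` (`riemannTheta_transform_const_mul`, uniqueness of the constant and the
cocycle `det(γZ + δ) = det(γ₁M₂(Z) + δ₁) det(γ₂Z + δ₂)`).
[cite: Lange2023AbelianVarietiesComplex, §3.3.4 Exercise (7)(a) (p0179); §3.3.3 Thm. 3.3.9 (p0175)] [cite: MumfordTata1, Ch. II §5] -/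
theorem sq_transform_const_mul {M₁ M₂ : Matrix.symplecticGroup (Fin g) ℤ}
    (hM₁ : M₁ ∈ thetaModularGroup g) (hM₂ : M₂ ∈ thetaModularGroup g) {u₁ u₂ : ℂ}
    (hu₁ : (∀ (Z : Matrix (Fin g) (Fin g) ℂ), Z ∈ siegelUpperHalfSpace g → ∀ C : ℂ,
        (∀ v : Fin g → ℂ,
          riemannTheta (moeb ((M₁ : Matrix (Fin g ⊕ Fin g) (Fin g ⊕ Fin g) ℤ).map ((↑) : ℤ → ℂ)) Z)
              ((denom ((M₁ : Matrix (Fin g ⊕ Fin g) (Fin g ⊕ Fin g) ℤ).map ((↑) : ℤ → ℂ)) Z)ᵀ⁻¹ *ᵥ v) =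
            C * cexp (π * I * (v ⬝ᵥ ((denom ((M₁ : Matrix (Fin g ⊕ Fin g) (Fin g ⊕ Fin g) ℤ).map
                  ((↑) : ℤ → ℂ)) Z)⁻¹ *
                ((M₁ : Matrix (Fin g ⊕ Fin g) (Fin g ⊕ Fin g) ℤ).map ((↑) : ℤ → ℂ)).toBlocks₂₁) *ᵥ v)) *
              riemannTheta Z v) →
        C ^ 2 = u₁ * (denom ((M₁ : Matrix (Fin g ⊕ Fin g) (Fin g ⊕ Fin g) ℤ).map ((↑) : ℤ → ℂ)) Z).det))
    (hu₂ : (∀ (Z : Matrix (Fin g) (Fin g) ℂ), Z ∈ siegelUpperHalfSpace g → ∀ C : ℂ,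
        (∀ v : Fin g → ℂ,
          riemannTheta (moeb ((M₂ : Matrix (Fin g ⊕ Fin g) (Fin g ⊕ Fin g) ℤ).map ((↑) : ℤ → ℂ)) Z)
              ((denom ((M₂ : Matrix (Fin g ⊕ Fin g) (Fin g ⊕ Fin g) ℤ).map ((↑) : ℤ → ℂ)) Z)ᵀ⁻¹ *ᵥ v) =
            C * cexp (π * I * (v ⬝ᵥ ((denom ((M₂ : Matrix (Fin g ⊕ Fin g) (Fin g ⊕ Fin g) ℤ).map
                  ((↑) : ℤ → ℂ)) Z)⁻¹ *
                ((M₂ : Matrix (Fin g ⊕ Fin g) (Fin g ⊕ Fin g) ℤ).map ((↑) : ℤ → ℂ)).toBlocks₂₁) *ᵥ v)) *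
              riemannTheta Z v) →
        C ^ 2 = u₂ * (denom ((M₂ : Matrix (Fin g ⊕ Fin g) (Fin g ⊕ Fin g) ℤ).map ((↑) : ℤ → ℂ)) Z).det)) :
    (∀ (Z : Matrix (Fin g) (Fin g) ℂ), Z ∈ siegelUpperHalfSpace g → ∀ C : ℂ,
        (∀ v : Fin g → ℂ,
          riemannTheta (moeb (((M₁ * M₂ : Matrix.symplecticGroup (Fin g) ℤ) : Matrix (Fin g ⊕ Fin g) (Fin g ⊕ Fin g) ℤ).map ((↑) : ℤ → ℂ)) Z)
              ((denom (((M₁ * M₂ : Matrix.symplecticGroup (Fin g) ℤ) : Matrix (Fin g ⊕ Fin g) (Fin g ⊕ Fin g) ℤ).map ((↑) : ℤ → ℂ)) Z)ᵀ⁻¹ *ᵥ v) =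
            C * cexp (π * I * (v ⬝ᵥ ((denom (((M₁ * M₂ : Matrix.symplecticGroup (Fin g) ℤ) : Matrix (Fin g ⊕ Fin g) (Fin g ⊕ Fin g) ℤ).map
                  ((↑) : ℤ → ℂ)) Z)⁻¹ *
                (((M₁ * M₂ : Matrix.symplecticGroup (Fin g) ℤ) : Matrix (Fin g ⊕ Fin g) (Fin g ⊕ Fin g) ℤ).map ((↑) : ℤ → ℂ)).toBlocks₂₁) *ᵥ v)) *
              riemannTheta Z v) →
        C ^ 2 = (u₁ * u₂) * (denom (((M₁ * M₂ : Matrix.symplecticGroup (Fin g) ℤ) : Matrix (Fin g ⊕ Fin g) (Fin g ⊕ Fin g) ℤ).map ((↑) : ℤ → ℂ)) Z).det) := by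
  intro Z hZ C hC
  have hZ₂ : moeb ((M₂ : Matrix (Fin g ⊕ Fin g) (Fin g ⊕ Fin g) ℤ).map ((↑) : ℤ → ℂ)) Z ∈
      siegelUpperHalfSpace g := moeb_intCast_mem M₂.2 hZ
  obtain ⟨C₂, -, hC₂⟩ := exists_riemannTheta_transform_of_mem_thetaModularGroup hM₂ hZ
  obtain ⟨C₁, -, hC₁⟩ := exists_riemannTheta_transform_of_mem_thetaModularGroup hM₁ hZ₂
  have h12 := riemannTheta_transform_const_mul hZ hC₁ hC₂
  -- `C = C₁ C₂` by uniqueness of the constant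
  have hCC : C = C₁ * C₂ :=
    riemannThetaChar_transform_const_unique hZ 0 0 (fun v => Complex.exp_ne_zero _)
      (fun v => by rw [riemannThetaChar_zero_zero, ← hC v, h12 v])
  have e1 := hu₁ _ hZ₂ C₁ hC₁
  have e2 := hu₂ _ hZ C₂ hC₂
  have h₂ : IsUnit (denom ((M₂ : Matrix (Fin g ⊕ Fin g) (Fin g ⊕ Fin g) ℤ).map ((↑) : ℤ → ℂ)) Z).det :=
    isUnit_det_denom_intCast M₂.2 hZ
  have hP : (((M₁ * M₂ : Matrix.symplecticGroup (Fin g) ℤ) :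
      Matrix (Fin g ⊕ Fin g) (Fin g ⊕ Fin g) ℤ).map ((↑) : ℤ → ℂ)) =
      (M₁ : Matrix (Fin g ⊕ Fin g) (Fin g ⊕ Fin g) ℤ).map ((↑) : ℤ → ℂ) *
        (M₂ : Matrix (Fin g ⊕ Fin g) (Fin g ⊕ Fin g) ℤ).map ((↑) : ℤ → ℂ) := by
    rw [Submonoid.coe_mul]
    exact Matrix.map_mul (f := Int.castRingHom ℂ)
  rw [hCC, mul_pow, e1, e2, hP, denom_mul_eq h₂, det_mul]
  ring

/-- **The multiplier of `ϑ²` on `Γ_{1,2}` is a unitary character** (Exercise 3.3.4 (7)(a) for the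
theta group, in the tree's normalisation): there is a monoid homomorphism `u : Γ_{1,2} →* ℂ` with
`|u(M)| = 1` such that for every `M = (α β; γ δ) ∈ Γ_{1,2}`, every `Z ∈ 𝔥_g` and every constant `C`
with `ϑ(ᵗ(γZ + δ)⁻¹v, M(Z)) = C · e(πi ᵗv(γZ + δ)⁻¹γv) · ϑ(v, Z)` for all `v`: `C² = u(M) · det(γZ + δ)`.
[cite: Lange2023AbelianVarietiesComplex, §3.3.4 Exercise (7)(a) (p0179); §3.3.3 Thm. 3.3.9 (p0175); §3.5.1 Lemma 3.5.1 (p0186)] [cite: MumfordTata1, Ch. II §5] -/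
theorem exists_thetaMultiplier_hom (g : ℕ) :
    ∃ u : thetaModularGroup g →* ℂ, (∀ M, ‖u M‖ = 1) ∧
      ∀ M : thetaModularGroup g, (∀ (Z : Matrix (Fin g) (Fin g) ℂ), Z ∈ siegelUpperHalfSpace g → ∀ C : ℂ,
        (∀ v : Fin g → ℂ,
          riemannTheta (moeb (((M.1 : Matrix.symplecticGroup (Fin g) ℤ) : Matrix (Fin g ⊕ Fin g) (Fin g ⊕ Fin g) ℤ).map ((↑) : ℤ → ℂ)) Z)
              ((denom (((M.1 : Matrix.symplecticGroup (Fin g) ℤ) : Matrix (Fin g ⊕ Fin g) (Fin g ⊕ Fin g) ℤ).map ((↑) : ℤ → ℂ)) Z)ᵀ⁻¹ *ᵥ v) =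
            C * cexp (π * I * (v ⬝ᵥ ((denom (((M.1 : Matrix.symplecticGroup (Fin g) ℤ) : Matrix (Fin g ⊕ Fin g) (Fin g ⊕ Fin g) ℤ).map
                  ((↑) : ℤ → ℂ)) Z)⁻¹ *
                (((M.1 : Matrix.symplecticGroup (Fin g) ℤ) : Matrix (Fin g ⊕ Fin g) (Fin g ⊕ Fin g) ℤ).map ((↑) : ℤ → ℂ)).toBlocks₂₁) *ᵥ v)) *
              riemannTheta Z v) →
        C ^ 2 = u M * (denom (((M.1 : Matrix.symplecticGroup (Fin g) ℤ) : Matrix (Fin g ⊕ Fin g) (Fin g ⊕ Fin g) ℤ).map ((↑) : ℤ → ℂ)) Z).det) := by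
  have hex := fun M : thetaModularGroup g =>
    exists_unit_sq_riemannTheta_transform_const_of_mem_thetaModularGroup M.2
  choose u hu husq using hex
  have hone : u 1 = 1 :=
    thetaMultiplier_unique (1 : thetaModularGroup g).2 (husq 1) sq_transform_const_one
  have hmul : ∀ M₁ M₂ : thetaModularGroup g, u (M₁ * M₂) = u M₁ * u M₂ := fun M₁ M₂ =>
    thetaMultiplier_unique (M₁ * M₂).2 (husq (M₁ * M₂))
      (sq_transform_const_mul M₁.2 M₂.2 (husq M₁) (husq M₂))
  exact ⟨{ toFun := u, map_one' := hone, map_mul' := hmul }, hu, husq⟩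

/-- **`ϑ(0, M(Z))² = u(M) det(γZ + δ) ϑ(0, Z)²` with a CHARACTER `u` of `Γ_{1,2}`**: the theta null
squared is a modular form of weight one for the theta group with the unitary character of
`exists_thetaMultiplier_hom` as multiplier system.
[cite: Lange2023AbelianVarietiesComplex, §3.3.3 Thm. 3.3.9 (p0175); §3.3.4 Exercise (7)(a) (p0179); §3.5.1 (p0186–p0187)] [cite: MumfordTata1, Ch. II §5] -/
theorem exists_thetaMultiplier_hom_riemannTheta_zero_moeb_sq (g : ℕ) :
    ∃ u : thetaModularGroup g →* ℂ, (∀ M, ‖u M‖ = 1) ∧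
      ∀ (M : thetaModularGroup g) (Z : Matrix (Fin g) (Fin g) ℂ), Z ∈ siegelUpperHalfSpace g →
        riemannTheta (moeb (((M.1 : Matrix.symplecticGroup (Fin g) ℤ) :
            Matrix (Fin g ⊕ Fin g) (Fin g ⊕ Fin g) ℤ).map ((↑) : ℤ → ℂ)) Z) 0 ^ 2 =
          u M * (denom (((M.1 : Matrix.symplecticGroup (Fin g) ℤ) :
            Matrix (Fin g ⊕ Fin g) (Fin g ⊕ Fin g) ℤ).map ((↑) : ℤ → ℂ)) Z).det * riemannTheta Z 0 ^ 2 := by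
  obtain ⟨u, hu, h⟩ := exists_thetaMultiplier_hom g
  refine ⟨u, hu, fun M Z hZ => ?_⟩
  obtain ⟨C, -, hC⟩ := exists_riemannTheta_transform_of_mem_thetaModularGroup M.2 hZ
  have h0 := hC 0
  rw [mulVec_zero, mulVec_zero, dotProduct_zero, mul_zero, Complex.exp_zero, mul_one] at h0
  rw [h0, mul_pow, h M Z hZ C hC]

end Multiplier

section Generators

/-! ### §3 Values on generators (Exercise 3.3.4 (7)(c)): `u(1 β; 0 1) = 1`, `u(α 0; 0 ᵗα⁻¹) = det α` -/

/-- **Translations**: for symmetric integral `β` with even diagonal (so that `(1 β; 0 1) ∈ Γ_{1,2}`)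
every transformation constant of `M = (1 β; 0 1)` is `C = 1` (`ϑ(v, Z + β) = ϑ(v, Z)`), hence
`C² = 1 · det(0·Z + 1)`: `u(1 β; 0 1) = 1` ("`κ²(1 β; 0 1) = 1`").
[cite: Lange2023AbelianVarietiesComplex, §3.3.4 Exercise (7)(c) (p0179); §3.3.3 Thm. 3.3.9 (p0175)] -/
theorem sq_transform_const_translation {β : Matrix (Fin g) (Fin g) ℤ} (hβ : β.IsSymm)
    (heven : ∀ i, Even (β i i)) {M : Matrix.symplecticGroup (Fin g) ℤ}
    (hM : (M : Matrix (Fin g ⊕ Fin g) (Fin g ⊕ Fin g) ℤ) = fromBlocks 1 β 0 1) :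
    (∀ (Z : Matrix (Fin g) (Fin g) ℂ), Z ∈ siegelUpperHalfSpace g → ∀ C : ℂ,
        (∀ v : Fin g → ℂ,
          riemannTheta (moeb ((M : Matrix (Fin g ⊕ Fin g) (Fin g ⊕ Fin g) ℤ).map ((↑) : ℤ → ℂ)) Z)
              ((denom ((M : Matrix (Fin g ⊕ Fin g) (Fin g ⊕ Fin g) ℤ).map ((↑) : ℤ → ℂ)) Z)ᵀ⁻¹ *ᵥ v) =
            C * cexp (π * I * (v ⬝ᵥ ((denom ((M : Matrix (Fin g ⊕ Fin g) (Fin g ⊕ Fin g) ℤ).map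
                  ((↑) : ℤ → ℂ)) Z)⁻¹ *
                ((M : Matrix (Fin g ⊕ Fin g) (Fin g ⊕ Fin g) ℤ).map ((↑) : ℤ → ℂ)).toBlocks₂₁) *ᵥ v)) *
              riemannTheta Z v) →
        C ^ 2 = 1 * (denom ((M : Matrix (Fin g ⊕ Fin g) (Fin g ⊕ Fin g) ℤ).map ((↑) : ℤ → ℂ)) Z).det) := by
  intro Z hZ C hC
  rw [hM] at hC
  rw [hM, denom_translation, det_one, mul_one]
  -- `ϑ(v, Z + β) = ϑ(v, Z)`
  choose k hk using heven
  have hhalf : ((2⁻¹ : ℂ) • fun i => ((Matrix.diag β i : ℤ) : ℂ)) = (0 : Fin g → ℂ) + fun i => (k i : ℂ) := by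
    funext i
    simp only [Pi.smul_apply, smul_eq_mul, Matrix.diag_apply, Pi.add_apply, Pi.zero_apply, zero_add]
    rw [hk i]
    push_cast
    ring
  have hper : ∀ v : Fin g → ℂ, riemannTheta (Z + β.map ((↑) : ℤ → ℂ)) v = riemannTheta Z v := by
    intro v
    have h := riemannThetaChar_transform_translation hβ Z 0 0 v
    rw [mulVec_zero, sub_zero, zero_add, zero_dotProduct, zero_dotProduct, mul_zero, neg_zero,
      zero_add, Complex.exp_zero, one_mul, riemannThetaChar_zero_zero, hhalf,
      riemannThetaChar_charShift_snd, zero_dotProduct, mul_zero, Complex.exp_zero, one_mul,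
      riemannThetaChar_zero_zero] at h
    exact h
  have h21 : ((fromBlocks 1 β 0 1 : Matrix (Fin g ⊕ Fin g) (Fin g ⊕ Fin g) ℤ).map ((↑) : ℤ → ℂ)).toBlocks₂₁ = 0 := by
    rw [fromBlocks_map, toBlocks_fromBlocks₂₁]
    exact Matrix.map_zero _ Int.cast_zero
  obtain ⟨v, hv⟩ := exists_riemannTheta_ne_zero_of_posDef Z hZ.2
  have h := hC v
  rw [moeb_translation, denom_translation, h21, transpose_one, inv_one, one_mulVec, Matrix.mul_zero,
    zero_mulVec, dotProduct_zero, mul_zero, Complex.exp_zero, mul_one, hper] at h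
  have hC1 : C = 1 := by
    have : C * riemannTheta Z v = 1 * riemannTheta Z v := by rw [one_mul]; exact h.symm
    exact mul_right_cancel₀ hv this
  rw [hC1, one_pow]

/-- **Diagonal elements**: for `α ∈ GL_g(ℤ)`, `δ = ᵗα⁻¹` (`ᵗαδ = 1`), every transformation constant of
`M = (α 0; 0 δ) ∈ Γ_{1,2}` is `C = 1` (`ϑ(αv, αZᵗα) = ϑ(v, Z)`), hence `C² = det α · det δ`:
`u(α 0; 0 ᵗα⁻¹) = det α = ±1` ("`κ²(α 0; 0 ᵗα⁻¹) = det(α)`").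
[cite: Lange2023AbelianVarietiesComplex, §3.3.4 Exercise (7)(c) (p0179); §3.3.3 Thm. 3.3.9 (p0175)] -/
theorem sq_transform_const_diag {α δ : Matrix (Fin g) (Fin g) ℤ} (h : αᵀ * δ = 1)
    {M : Matrix.symplecticGroup (Fin g) ℤ}
    (hM : (M : Matrix (Fin g ⊕ Fin g) (Fin g ⊕ Fin g) ℤ) = fromBlocks α 0 0 δ) :
    (∀ (Z : Matrix (Fin g) (Fin g) ℂ), Z ∈ siegelUpperHalfSpace g → ∀ C : ℂ,
        (∀ v : Fin g → ℂ,
          riemannTheta (moeb ((M : Matrix (Fin g ⊕ Fin g) (Fin g ⊕ Fin g) ℤ).map ((↑) : ℤ → ℂ)) Z)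
              ((denom ((M : Matrix (Fin g ⊕ Fin g) (Fin g ⊕ Fin g) ℤ).map ((↑) : ℤ → ℂ)) Z)ᵀ⁻¹ *ᵥ v) =
            C * cexp (π * I * (v ⬝ᵥ ((denom ((M : Matrix (Fin g ⊕ Fin g) (Fin g ⊕ Fin g) ℤ).map
                  ((↑) : ℤ → ℂ)) Z)⁻¹ *
                ((M : Matrix (Fin g ⊕ Fin g) (Fin g ⊕ Fin g) ℤ).map ((↑) : ℤ → ℂ)).toBlocks₂₁) *ᵥ v)) *
              riemannTheta Z v) →
        C ^ 2 = ((α.map ((↑) : ℤ → ℂ)).det) * (denom ((M : Matrix (Fin g ⊕ Fin g) (Fin g ⊕ Fin g) ℤ).map ((↑) : ℤ → ℂ)) Z).det) := by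
  intro Z hZ C hC
  rw [hM] at hC
  obtain ⟨hden, hmo⟩ := denom_moeb_diag α δ Z
  have hc : (α.map ((↑) : ℤ → ℂ))ᵀ * δ.map ((↑) : ℤ → ℂ) = 1 := by
    have := congrArg (fun N : Matrix (Fin g) (Fin g) ℤ => N.map (Int.castRingHom ℂ)) h
    rw [Matrix.map_mul, Matrix.map_one _ (map_zero _) (map_one _), transpose_map] at this
    exact this
  have hcT : (δ.map ((↑) : ℤ → ℂ))ᵀ * α.map ((↑) : ℤ → ℂ) = 1 := by
    simpa [transpose_mul, transpose_transpose] using congrArg transpose hc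
  have hδinv : (δ.map ((↑) : ℤ → ℂ))⁻¹ = (α.map ((↑) : ℤ → ℂ))ᵀ := Matrix.inv_eq_left_inv hc
  have hδTinv : (δ.map ((↑) : ℤ → ℂ))ᵀ⁻¹ = α.map ((↑) : ℤ → ℂ) := Matrix.inv_eq_right_inv hcT
  have h21 : ((fromBlocks α 0 0 δ : Matrix (Fin g ⊕ Fin g) (Fin g ⊕ Fin g) ℤ).map ((↑) : ℤ → ℂ)).toBlocks₂₁ = 0 := by
    rw [fromBlocks_map, toBlocks_fromBlocks₂₁]
    exact Matrix.map_zero _ Int.cast_zero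
  have hdet : (α.map ((↑) : ℤ → ℂ)).det * (δ.map ((↑) : ℤ → ℂ)).det = 1 := by
    rw [← det_transpose (α.map _), ← det_mul, hc, det_one]
  rw [hM, hden, hdet]
  obtain ⟨v, hv⟩ := exists_riemannTheta_ne_zero_of_posDef Z hZ.2
  have hθ := riemannThetaChar_transform_diag h Z 0 0 v
  rw [mulVec_zero, mulVec_zero, riemannThetaChar_zero_zero, riemannThetaChar_zero_zero] at hθ
  have h' := hC v
  rw [hmo, hden, hδinv, hδTinv, h21, Matrix.mul_zero, zero_mulVec, dotProduct_zero, mul_zero,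
    Complex.exp_zero, mul_one, hθ] at h'
  have hC1 : C = 1 := by
    have : C * riemannTheta Z v = 1 * riemannTheta Z v := by rw [one_mul]; exact h'.symm
    exact mul_right_cancel₀ hv this
  rw [hC1, one_pow]

/-- **Values of the character on the generators inside `Γ_{1,2}`**: for any `u` with the defining
property of `exists_thetaMultiplier_hom` (in particular for that unitary character),
`u(1 β; 0 1) = 1` for symmetric `β` with even diagonal, and `u(α 0; 0 ᵗα⁻¹) = det α`.
[cite: Lange2023AbelianVarietiesComplex, §3.3.4 Exercise (7)(c) (p0179)] -/
theorem thetaMultiplier_translation_diag (u : thetaModularGroup g →* ℂ)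
    (hu : ∀ M : thetaModularGroup g, (∀ (Z : Matrix (Fin g) (Fin g) ℂ), Z ∈ siegelUpperHalfSpace g → ∀ C : ℂ,
        (∀ v : Fin g → ℂ,
          riemannTheta (moeb (((M.1 : Matrix.symplecticGroup (Fin g) ℤ) : Matrix (Fin g ⊕ Fin g) (Fin g ⊕ Fin g) ℤ).map ((↑) : ℤ → ℂ)) Z)
              ((denom (((M.1 : Matrix.symplecticGroup (Fin g) ℤ) : Matrix (Fin g ⊕ Fin g) (Fin g ⊕ Fin g) ℤ).map ((↑) : ℤ → ℂ)) Z)ᵀ⁻¹ *ᵥ v) =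
            C * cexp (π * I * (v ⬝ᵥ ((denom (((M.1 : Matrix.symplecticGroup (Fin g) ℤ) : Matrix (Fin g ⊕ Fin g) (Fin g ⊕ Fin g) ℤ).map
                  ((↑) : ℤ → ℂ)) Z)⁻¹ *
                (((M.1 : Matrix.symplecticGroup (Fin g) ℤ) : Matrix (Fin g ⊕ Fin g) (Fin g ⊕ Fin g) ℤ).map ((↑) : ℤ → ℂ)).toBlocks₂₁) *ᵥ v)) *
              riemannTheta Z v) →
        C ^ 2 = u M * (denom (((M.1 : Matrix.symplecticGroup (Fin g) ℤ) : Matrix (Fin g ⊕ Fin g) (Fin g ⊕ Fin g) ℤ).map ((↑) : ℤ → ℂ)) Z).det)) :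
    (∀ (M : thetaModularGroup g) (β : Matrix (Fin g) (Fin g) ℤ), β.IsSymm → (∀ i, Even (β i i)) →
        ((M.1 : Matrix.symplecticGroup (Fin g) ℤ) : Matrix (Fin g ⊕ Fin g) (Fin g ⊕ Fin g) ℤ) =
          fromBlocks 1 β 0 1 → u M = 1) ∧
      ∀ (M : thetaModularGroup g) (α δ : Matrix (Fin g) (Fin g) ℤ), αᵀ * δ = 1 →
        ((M.1 : Matrix.symplecticGroup (Fin g) ℤ) : Matrix (Fin g ⊕ Fin g) (Fin g ⊕ Fin g) ℤ) =
          fromBlocks α 0 0 δ → u M = (α.map ((↑) : ℤ → ℂ)).det := by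
  refine ⟨fun M β hβ heven hM => ?_, fun M α δ h hM => ?_⟩
  · exact thetaMultiplier_unique M.2 (hu M) (sq_transform_const_translation hβ heven hM)
  · exact thetaMultiplier_unique M.2 (hu M) (sq_transform_const_diag h hM)

/-! ### §4 The value on `J = (0 -1; 1 0)`: `u(J) = (-i)^g` (Exercise 3.3.4 (7)(c), first value) -/

/-- `ϑ(0, i·1_g) = Σ_m e^{-π|m|²} ≠ 0` (a sum of positive reals). [folklore] -/
private theorem riemannTheta_I_smul_one_zero_ne_zero :
    riemannTheta (Complex.I • (1 : Matrix (Fin g) (Fin g) ℂ)) 0 ≠ 0 := by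
  have hterm : ∀ m : Fin g → ℤ, riemannThetaTerm (Complex.I • (1 : Matrix (Fin g) (Fin g) ℂ)) 0 m =
      ((rexp (-(π * ∑ i, (m i : ℝ) ^ 2)) : ℝ) : ℂ) := by
    intro m
    unfold riemannThetaTerm
    have hq : ∑ i, ∑ j, (m i : ℂ) * (Complex.I • (1 : Matrix (Fin g) (Fin g) ℂ)) i j * (m j : ℂ) =
        I * ∑ i, (((m i : ℝ) ^ 2 : ℝ) : ℂ) := by
      rw [Finset.mul_sum]
      refine Finset.sum_congr rfl fun i _ => ?_
      rw [Finset.sum_eq_single i]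
      · simp only [Matrix.smul_apply, Matrix.one_apply_eq, smul_eq_mul, mul_one]
        push_cast
        ring
      · intro j _ hji
        simp [Matrix.one_apply_ne (Ne.symm hji)]
      · simp
    rw [hq, Complex.ofReal_exp]
    congr 1
    simp only [Pi.zero_apply, mul_zero, Finset.sum_const_zero, add_zero]
    push_cast
    rw [← mul_assoc, mul_assoc (π : ℂ) I I, Complex.I_mul_I]
    ring
  have hs : Summable fun m : Fin g → ℤ => rexp (-(π * ∑ i, (m i : ℝ) ^ 2)) := by
    refine (summable_prod_exp_neg_mul_sq (g := g) Real.pi_pos).congr fun m => ?_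
    rw [← Real.exp_sum, Finset.mul_sum, ← Finset.sum_neg_distrib]
  have hpos : 0 < ∑' m : Fin g → ℤ, rexp (-(π * ∑ i, (m i : ℝ) ^ 2)) :=
    hs.tsum_pos (fun m => (Real.exp_pos _).le) 0 (Real.exp_pos _)
  have h : riemannTheta (Complex.I • (1 : Matrix (Fin g) (Fin g) ℂ)) 0 =
      ((∑' m : Fin g → ℤ, rexp (-(π * ∑ i, (m i : ℝ) ^ 2)) : ℝ) : ℂ) := by
    rw [riemannTheta_def, Complex.ofReal_tsum]
    exact tsum_congr hterm
  rw [h]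
  exact_mod_cast hpos.ne'

/-- **`J = (0 -1; 1 0)`**: every transformation constant of `J ∈ Γ_{1,2}` at `Z ∈ 𝔥_g` satisfies
`C² = (-i)^g det Z` (`γZ + δ = Z` here), i.e. **`u(J) = (-i)^g`** — at the fixed point `Z₀ = i·1_g` of `J`
(`J(i1_g) = -(i1_g)⁻¹ = i1_g`, `ᵗ(γZ₀ + δ)⁻¹·0 = 0`) the law at `v = 0` reads `ϑ(0, i1_g) = C₀ ϑ(0, i1_g)`, so
`C₀ = 1` and `u(J) = C₀²/det(i1_g) = i^{-g}`; the value at every other `Z` follows because `u(J)` does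
not depend on `Z` (`exists_unit_sq_riemannTheta_transform_const_of_mem_thetaModularGroup`). For
`g = 1` this is `C(τ)² = -iτ`, the square of the tree's `riemannThetaChar_transform_J_fin_one`;
printed: "`κ²(0 1; -1 0) = (-i)^g`" (for the inverse matrix and `κ² = u⁻¹` on `Γ_{1,2}`).
[cite: Lange2023AbelianVarietiesComplex, §3.3.4 Exercise (7)(c) (p0179); §3.3.3 Thm. 3.3.9 (p0175)] [cite: MumfordTata1, Ch. II §5] -/
theorem sq_transform_const_J {M : Matrix.symplecticGroup (Fin g) ℤ}
    (hM : (M : Matrix (Fin g ⊕ Fin g) (Fin g ⊕ Fin g) ℤ) = Matrix.J (Fin g) ℤ) :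
    (∀ (Z : Matrix (Fin g) (Fin g) ℂ), Z ∈ siegelUpperHalfSpace g → ∀ C : ℂ,
        (∀ v : Fin g → ℂ,
          riemannTheta (moeb ((M : Matrix (Fin g ⊕ Fin g) (Fin g ⊕ Fin g) ℤ).map ((↑) : ℤ → ℂ)) Z)
              ((denom ((M : Matrix (Fin g ⊕ Fin g) (Fin g ⊕ Fin g) ℤ).map ((↑) : ℤ → ℂ)) Z)ᵀ⁻¹ *ᵥ v) =
            C * cexp (π * I * (v ⬝ᵥ ((denom ((M : Matrix (Fin g ⊕ Fin g) (Fin g ⊕ Fin g) ℤ).map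
                  ((↑) : ℤ → ℂ)) Z)⁻¹ *
                ((M : Matrix (Fin g ⊕ Fin g) (Fin g ⊕ Fin g) ℤ).map ((↑) : ℤ → ℂ)).toBlocks₂₁) *ᵥ v)) *
              riemannTheta Z v) →
        C ^ 2 = (-Complex.I) ^ g * (denom ((M : Matrix (Fin g ⊕ Fin g) (Fin g ⊕ Fin g) ℤ).map ((↑) : ℤ → ℂ)) Z).det) := by
  intro Z hZ C hC
  have hMJ : M = SymplecticGroup.symJ (Fin g) ℤ := Subtype.ext hM
  subst hMJ
  obtain ⟨u, -, husq⟩ :=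
    exists_unit_sq_riemannTheta_transform_const_of_mem_thetaModularGroup (symJ_mem_thetaModularGroup (g := g))
  -- the fixed point `Z₀ = i 1_g`
  have hI : (Complex.I • (1 : Matrix (Fin g) (Fin g) ℂ)) ∈ siegelUpperHalfSpace g :=
    ⟨isSymm_I_smul_one, posDef_im_I_smul_one⟩
  obtain ⟨C₀, -, hC₀⟩ := exists_riemannTheta_transform_of_mem_thetaModularGroup
    (symJ_mem_thetaModularGroup (g := g)) hI
  obtain ⟨hd₀, -, hm₀⟩ := denom_moeb_J (g := g) (Complex.I • (1 : Matrix (Fin g) (Fin g) ℂ))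
  have hinv : (Complex.I • (1 : Matrix (Fin g) (Fin g) ℂ))⁻¹ = (-Complex.I) • (1 : Matrix (Fin g) (Fin g) ℂ) := by
    refine Matrix.inv_eq_left_inv ?_
    rw [Matrix.smul_mul, Matrix.one_mul, smul_smul, neg_mul, Complex.I_mul_I, neg_neg, one_smul]
  have hfix : moeb ((Matrix.J (Fin g) ℤ).map ((↑) : ℤ → ℂ)) (Complex.I • 1) = Complex.I • 1 := by
    rw [hm₀, hinv, neg_smul, neg_neg]
  have h0 := hC₀ 0
  rw [SymplecticGroup.coe_J, mulVec_zero, mulVec_zero, dotProduct_zero, mul_zero, Complex.exp_zero,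
    mul_one, hfix] at h0
  have hC₀1 : C₀ = 1 := by
    have : C₀ * riemannTheta (Complex.I • (1 : Matrix (Fin g) (Fin g) ℂ)) 0 =
        1 * riemannTheta (Complex.I • (1 : Matrix (Fin g) (Fin g) ℂ)) 0 := by rw [one_mul]; exact h0.symm
    exact mul_right_cancel₀ riemannTheta_I_smul_one_zero_ne_zero this
  -- `u = (-i)^g`
  have hu0 := husq _ hI C₀ hC₀
  rw [SymplecticGroup.coe_J, hd₀, hC₀1, one_pow, det_smul, det_one, mul_one, Fintype.card_fin] at hu0
  have hIg : (Complex.I : ℂ) ^ g ≠ 0 := pow_ne_zero _ Complex.I_ne_zero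
  have hu : u = (-Complex.I) ^ g := by
    have h1 : u * Complex.I ^ g * (-Complex.I) ^ g = (-Complex.I) ^ g := by rw [← hu0, one_mul]
    rw [mul_assoc, ← mul_pow, mul_neg, Complex.I_mul_I, neg_neg, one_pow, mul_one] at h1
    exact h1
  rw [← hu]
  exact husq Z hZ C hC

/-- **`u(J) = (-i)^g` for the character of `exists_thetaMultiplier_hom`** (or any `u` with its defining
property). [cite: Lange2023AbelianVarietiesComplex, §3.3.4 Exercise (7)(c) (p0179)] [cite: MumfordTata1, Ch. II §5] -/
theorem thetaMultiplier_J (u : thetaModularGroup g →* ℂ)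
    (hu : ∀ M : thetaModularGroup g, (∀ (Z : Matrix (Fin g) (Fin g) ℂ), Z ∈ siegelUpperHalfSpace g → ∀ C : ℂ,
        (∀ v : Fin g → ℂ,
          riemannTheta (moeb (((M.1 : Matrix.symplecticGroup (Fin g) ℤ) : Matrix (Fin g ⊕ Fin g) (Fin g ⊕ Fin g) ℤ).map ((↑) : ℤ → ℂ)) Z)
              ((denom (((M.1 : Matrix.symplecticGroup (Fin g) ℤ) : Matrix (Fin g ⊕ Fin g) (Fin g ⊕ Fin g) ℤ).map ((↑) : ℤ → ℂ)) Z)ᵀ⁻¹ *ᵥ v) =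
            C * cexp (π * I * (v ⬝ᵥ ((denom (((M.1 : Matrix.symplecticGroup (Fin g) ℤ) : Matrix (Fin g ⊕ Fin g) (Fin g ⊕ Fin g) ℤ).map
                  ((↑) : ℤ → ℂ)) Z)⁻¹ *
                (((M.1 : Matrix.symplecticGroup (Fin g) ℤ) : Matrix (Fin g ⊕ Fin g) (Fin g ⊕ Fin g) ℤ).map ((↑) : ℤ → ℂ)).toBlocks₂₁) *ᵥ v)) *
              riemannTheta Z v) →
        C ^ 2 = u M * (denom (((M.1 : Matrix.symplecticGroup (Fin g) ℤ) : Matrix (Fin g ⊕ Fin g) (Fin g ⊕ Fin g) ℤ).map ((↑) : ℤ → ℂ)) Z).det))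
    (M : thetaModularGroup g)
    (hM : ((M.1 : Matrix.symplecticGroup (Fin g) ℤ) : Matrix (Fin g ⊕ Fin g) (Fin g ⊕ Fin g) ℤ) =
      Matrix.J (Fin g) ℤ) :
    u M = (-Complex.I) ^ g :=
  thetaMultiplier_unique M.2 (hu M) (sq_transform_const_J hM)

/-- **The theta inversion formula, squared** (`M = J`): for `Z ∈ 𝔥_g` there is `C` with
**`C² = (-i)^g det Z`** and `ϑ(Z⁻¹v, -Z⁻¹) = C · e(πi ᵗvZ⁻¹v) · ϑ(v, Z)` for all `v ∈ ℂ^g` — Mumford's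
`ϑ(ᵗΩ⁻¹z, -Ω⁻¹) = det(Ω/i)^{1/2} exp(πi ᵗzΩ⁻¹z) ϑ(z, Ω)` up to the sign of the root, here obtained from
the transformation formula "up to the constant", the holomorphy/constancy argument of Thm. 3.3.9
Step II and the fixed point `i1_g` (no `g`-dimensional Poisson summation).
[cite: MumfordTata1, Ch. II §5] [cite: Lange2023AbelianVarietiesComplex, §3.3.3 Thm. 3.3.9 (p0175); §3.3.4 Exercise (7)(c) (p0179)] -/
theorem exists_riemannTheta_inv_transform_sq {Z : Matrix (Fin g) (Fin g) ℂ}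
    (hZ : Z ∈ siegelUpperHalfSpace g) :
    ∃ C : ℂ, C ^ 2 = (-Complex.I) ^ g * Z.det ∧ ∀ v : Fin g → ℂ,
      riemannTheta (-Z⁻¹) (Z⁻¹ *ᵥ v) = C * cexp (π * I * (v ⬝ᵥ Z⁻¹ *ᵥ v)) * riemannTheta Z v := by
  obtain ⟨C, -, hC⟩ := exists_riemannTheta_transform_of_mem_thetaModularGroup
    (symJ_mem_thetaModularGroup (g := g)) hZ
  obtain ⟨hd, h21, hm⟩ := denom_moeb_J (g := g) Z
  have hsq := sq_transform_const_J (M := SymplecticGroup.symJ (Fin g) ℤ) SymplecticGroup.coe_J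
    Z hZ C hC
  rw [SymplecticGroup.coe_J, hd] at hsq
  refine ⟨C, hsq, fun v => ?_⟩
  have h := hC v
  rw [SymplecticGroup.coe_J, hd, h21, hm, hZ.1.eq, Matrix.mul_one] at h
  exact h

end Generators


end Literature.NumberTheory.ModularForms

end
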